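import Summits.HubbardSuperconductivity.HubbardSuperconductivity.Theorems.WidthHaldaneTubeTwoCut
import Literature.MathematicalPhysics.QuantumLattice.FermionHopAmplitudeBound
import Literature.MathematicalPhysics.QuantumLattice.FinDimSpectrumSectorGibbsLimit

/-!
# The flux envelope of the Hubbard tube is Lipschitz in the flux

Support file for the cruxes stated over `WidthHaldaneDefs` (routes `WidthHaldane`, `SeamInduction`;
items stmt-HubbardSuperconductivity-16310/16311/16312/18509/18510). The two twisted tubes
`tubeH0 + tubeTwist θ₁` and `tubeH0 + tubeTwist θ₂` differ by the seam term only, whose expectation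
in a unit vector changes by at most `2M|θ₁ - θ₂|` (`2M` oriented seam hops of modulus `≤ 1/2` per
spin, `|e^{± iθ₁} - e^{± iθ₂}| ≤ |θ₁ - θ₂|`); pricing a near-minimiser of one in the other gives,
for every `U`, `N`, `L ≥ 2`, `M` and every labelling — all PROVED, no definitions, no named facts:

* `abs_re_expect_tubeTwist_sub_le` — the seam twist is `2M`-Lipschitz in expectation;
* `tubeEnergy_le_tubeEnergy_add_lipschitz`, `abs_tubeEnergy_sub_le` —
  `|E_{L,M}(U; θ₁, N) - E_{L,M}(U; θ₂, N)| ≤ 2M|θ₁ - θ₂|`;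
* `continuous_tubeEnergy` — `θ ↦ E_{L,M}(U; θ, N)` is continuous (the kinematic modulus of the
  sector-minimum envelope, a minimum of finitely many analytic eigenvalue branches; needed by any
  "path in the flux" argument, e.g. the idea cards `kohn-curvature-path`, `two-cut-transparency`).

Reference: O. Bratteli, D. W. Robinson, *Operator Algebras and Quantum Statistical Mechanics II*,
Prop. 5.2.2 (`‖a(f)‖ = ‖f‖`, hopping amplitudes); Weyl's inequality for minima of quadratic forms.
-/

noncomputable section

namespace Summit.HubbardSuperconductivity.HubbardSuperconductivity.Theorems.WidthHaldane

set_option linter.dupNamespace false -- summit = problem name (single-conjunct summit), D-0017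

open scoped BigOperators Classical Matrix ComplexConjugate
open Matrix Literature.MathematicalPhysics.QuantumLattice

section Lipschitz

variable (L M : ℕ) [NeZero L] [NeZero M] (Λ : Type) [LinearOrder Λ] [Fintype Λ]
  (e : Λ ≃ ZMod L × ZMod M)

omit [NeZero L] [NeZero M] [LinearOrder Λ] [Fintype Λ] in
/-- `|e^{iθ₁} - e^{iθ₂}| ≤ |θ₁ - θ₂|`. [folklore] -/
theorem norm_exp_I_mul_sub_le (θ₁ θ₂ : ℝ) :
    ‖Complex.exp (Complex.I * θ₁) - Complex.exp (Complex.I * θ₂)‖ ≤ |θ₁ - θ₂| := by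
  have h := Real.norm_exp_I_mul_ofReal_sub_one_le (x := θ₁ - θ₂)
  have hfac : Complex.exp (Complex.I * θ₁) - Complex.exp (Complex.I * θ₂) =
      Complex.exp (Complex.I * θ₂) * (Complex.exp (Complex.I * ((θ₁ - θ₂ : ℝ) : ℂ)) - 1) := by
    rw [mul_sub, mul_one, ← Complex.exp_add]
    congr 1
    push_cast
    ring
  rw [hfac, norm_mul, Complex.norm_exp_I_mul_ofReal, one_mul]
  rwa [Real.norm_eq_abs] at h

omit [NeZero L] [NeZero M] [LinearOrder Λ] [Fintype Λ] in
/-- `|e^{-iθ₁} - e^{-iθ₂}| ≤ |θ₁ - θ₂|`. [folklore] -/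
theorem norm_exp_neg_I_mul_sub_le (θ₁ θ₂ : ℝ) :
    ‖Complex.exp (-(Complex.I * θ₁)) - Complex.exp (-(Complex.I * θ₂))‖ ≤ |θ₁ - θ₂| := by
  have h := norm_exp_I_mul_sub_le (-θ₁) (-θ₂)
  simp only [Complex.ofReal_neg, mul_neg] at h
  rwa [show (-θ₁ - -θ₂ : ℝ) = -(θ₁ - θ₂) by ring, abs_neg] at h

/-- **The seam twist is Lipschitz in the flux, in expectation**: for a unit vector and `L ≥ 2`,
`|Re⟨ψ, Tw_{θ₁} ψ⟩ - Re⟨ψ, Tw_{θ₂} ψ⟩| ≤ 2M|θ₁ - θ₂|` (`2M` oriented seam hops per spin orientation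
pair, each amplitude of modulus `≤ 1/2`, `|e^{± iθ₁} - e^{± iθ₂}| ≤ |θ₁ - θ₂|`). [folklore] -/
theorem abs_re_expect_tubeTwist_sub_le (hL : 2 ≤ L) (θ₁ θ₂ : ℝ) {ψ : Fock (Orb Λ)} (h1 : star ψ ⬝ᵥ ψ = 1) :
    |(expect (tubeTwist L M Λ e θ₁) ψ).re - (expect (tubeTwist L M Λ e θ₂) ψ).re| ≤ 2 * M * |θ₁ - θ₂| := by
  haveI : Fact (1 < L) := ⟨by omega⟩
  have hne : ∀ b : ZMod M, ∀ σ : Fin 2, orb (e.symm (0, b)) σ ≠ orb (e.symm (-1, b)) σ := by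
    intro b σ h
    have h2 := congrArg Prod.fst (e.symm.injective (congrArg (fun o : Orb Λ => (ofLex o).1) h))
    exact one_ne_zero (neg_eq_zero.1 h2.symm)
  have hE := norm_exp_I_mul_sub_le θ₁ θ₂
  have hE' := norm_exp_neg_I_mul_sub_le θ₁ θ₂
  rw [expect_tubeTwist, expect_tubeTwist, ← Complex.sub_re, ← Finset.sum_sub_distrib]
  refine (Complex.abs_re_le_norm _).trans ((norm_sum_le _ _).trans ?_)
  have hterm : ∀ b ∈ (Finset.univ : Finset (ZMod M)),
      ‖∑ σ : Fin 2, ((1 - Complex.exp (Complex.I * θ₁)) *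
          expect (creation (orb (e.symm (0, b)) σ) * annihilation (orb (e.symm (-1, b)) σ)) ψ +
        (1 - Complex.exp (-(Complex.I * θ₁))) *
          expect (creation (orb (e.symm (-1, b)) σ) * annihilation (orb (e.symm (0, b)) σ)) ψ) -
       ∑ σ : Fin 2, ((1 - Complex.exp (Complex.I * θ₂)) *
          expect (creation (orb (e.symm (0, b)) σ) * annihilation (orb (e.symm (-1, b)) σ)) ψ +
        (1 - Complex.exp (-(Complex.I * θ₂))) *
          expect (creation (orb (e.symm (-1, b)) σ) * annihilation (orb (e.symm (0, b)) σ)) ψ)‖ ≤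
      2 * |θ₁ - θ₂| := by
    intro b _
    rw [← Finset.sum_sub_distrib]
    refine (norm_sum_le _ _).trans ?_
    have hσ : ∀ σ ∈ (Finset.univ : Finset (Fin 2)),
        ‖((1 - Complex.exp (Complex.I * θ₁)) *
            expect (creation (orb (e.symm (0, b)) σ) * annihilation (orb (e.symm (-1, b)) σ)) ψ +
          (1 - Complex.exp (-(Complex.I * θ₁))) *
            expect (creation (orb (e.symm (-1, b)) σ) * annihilation (orb (e.symm (0, b)) σ)) ψ) -
         ((1 - Complex.exp (Complex.I * θ₂)) *
            expect (creation (orb (e.symm (0, b)) σ) * annihilation (orb (e.symm (-1, b)) σ)) ψ +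
          (1 - Complex.exp (-(Complex.I * θ₂))) *
            expect (creation (orb (e.symm (-1, b)) σ) * annihilation (orb (e.symm (0, b)) σ)) ψ)‖ ≤
        |θ₁ - θ₂| := by
      intro σ _
      have hA := norm_star_dotProduct_creation_mul_annihilation_mulVec_le_half h1 (hne b σ)
      have hB := norm_star_dotProduct_creation_mul_annihilation_mulVec_le_half h1 (hne b σ).symm
      unfold expect
      rw [show ∀ (A B : ℂ), ((1 - Complex.exp (Complex.I * θ₁)) * A + (1 - Complex.exp (-(Complex.I * θ₁))) * B) -
          ((1 - Complex.exp (Complex.I * θ₂)) * A + (1 - Complex.exp (-(Complex.I * θ₂))) * B) =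
          -(Complex.exp (Complex.I * θ₁) - Complex.exp (Complex.I * θ₂)) * A +
            -(Complex.exp (-(Complex.I * θ₁)) - Complex.exp (-(Complex.I * θ₂))) * B from fun A B => by ring]
      refine (norm_add_le _ _).trans ?_
      rw [norm_mul, norm_mul, norm_neg, norm_neg]
      nlinarith [norm_nonneg (Complex.exp (Complex.I * θ₁) - Complex.exp (Complex.I * θ₂)),
        norm_nonneg (Complex.exp (-(Complex.I * θ₁)) - Complex.exp (-(Complex.I * θ₂))),
        norm_nonneg (star ψ ⬝ᵥ (creation (orb (e.symm (0, b)) σ) * annihilation (orb (e.symm (-1, b)) σ)) *ᵥ ψ),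
        norm_nonneg (star ψ ⬝ᵥ (creation (orb (e.symm (-1, b)) σ) * annihilation (orb (e.symm (0, b)) σ)) *ᵥ ψ)]
    refine (Finset.sum_le_sum hσ).trans ?_
    rw [Finset.sum_const, Finset.card_univ, Fintype.card_fin, nsmul_eq_mul, Nat.cast_ofNat]
  refine (Finset.sum_le_sum hterm).trans ?_
  rw [Finset.sum_const, Finset.card_univ, ZMod.card, nsmul_eq_mul]
  linarith

/-- **The flux envelope is Lipschitz**: `E_{L,M}(U; θ₁, N) ≤ E_{L,M}(U; θ₂, N) + 2M|θ₁ - θ₂|` for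
every `U`, `N`, `L ≥ 2`, `M` and every labelling (the two twisted Hamiltonians differ by the seam
term only; price a near-minimiser of one in the other). [folklore] -/
theorem tubeEnergy_le_tubeEnergy_add_lipschitz (hL : 2 ≤ L) (U θ₁ θ₂ : ℝ) (N : ℕ) :
    tubeEnergy L M Λ e U θ₁ N ≤ tubeEnergy L M Λ e U θ₂ N + 2 * M * |θ₁ - θ₂| := by
  have hc : 0 ≤ 2 * (M : ℝ) * |θ₁ - θ₂| := by positivity
  by_cases hne : ∃ ψ ∈ szSector (Λ := Λ) N 0, star ψ ⬝ᵥ ψ = (1 : ℂ)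
  · obtain ⟨ψ₀, hψ₀, h₀⟩ := hne
    have hS : {E : ℝ | ∃ ψ ∈ szSector (Λ := Λ) N 0, star ψ ⬝ᵥ ψ = 1 ∧
        E = (star ψ ⬝ᵥ ((tubeH0 L M Λ e U + tubeTwist L M Λ e θ₂) *ᵥ ψ)).re}.Nonempty :=
      ⟨_, ψ₀, hψ₀, h₀, rfl⟩
    have h0 : tubeEnergy L M Λ e U θ₂ N = sInf {E : ℝ | ∃ ψ ∈ szSector (Λ := Λ) N 0, star ψ ⬝ᵥ ψ = 1 ∧
        E = (star ψ ⬝ᵥ ((tubeH0 L M Λ e U + tubeTwist L M Λ e θ₂) *ᵥ ψ)).re} := rfl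
    refine le_of_forall_pos_lt_add fun ε hε => ?_
    obtain ⟨E, ⟨ψ, hψ, h1, rfl⟩, hE⟩ := exists_lt_of_csInf_lt hS
      (lt_add_of_pos_right (sInf {E : ℝ | ∃ ψ ∈ szSector (Λ := Λ) N 0, star ψ ⬝ᵥ ψ = 1 ∧
        E = (star ψ ⬝ᵥ ((tubeH0 L M Λ e U + tubeTwist L M Λ e θ₂) *ᵥ ψ)).re}) hε)
    -- price `ψ` in the `θ₁` Hamiltonian
    have hvar := minEnergyOn_le_rayleigh_of_mem (isHermitian_tubeH L M Λ e U θ₁) (szSector N 0) hψ h1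
    have hdiff := (abs_sub_le_iff.1 (abs_re_expect_tubeTwist_sub_le L M Λ e hL θ₁ θ₂ h1)).1
    have hsplit : ∀ θ, (star ψ ⬝ᵥ ((tubeH0 L M Λ e U + tubeTwist L M Λ e θ) *ᵥ ψ)).re =
        (expect (tubeH0 L M Λ e U) ψ).re + (expect (tubeTwist L M Λ e θ) ψ).re := by
      intro θ
      rw [add_mulVec, dotProduct_add, Complex.add_re]
      rfl
    rw [hsplit] at hE
    rw [h0, tubeEnergy_eq]
    have hvar' : (tubeH0 L M Λ e U + tubeTwist L M Λ e θ₁).minEnergyOn (szSector N 0) ≤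
        (expect (tubeH0 L M Λ e U) ψ).re + (expect (tubeTwist L M Λ e θ₁) ψ).re := by
      rw [← hsplit]; exact hvar
    linarith
  · have hempty : ∀ A : Matrix (Finset (Orb Λ)) (Finset (Orb Λ)) ℂ, A.minEnergyOn (szSector N 0) = 0 :=
      fun A => by
      unfold Matrix.minEnergyOn
      convert Real.sInf_empty
      ext E
      simp only [Set.mem_setOf_eq, Set.mem_empty_iff_false, iff_false, not_exists, not_and]
      exact fun ψ hψ h1 _ => hne ⟨ψ, hψ, h1⟩
    rw [tubeEnergy_eq, tubeEnergy_eq, hempty, hempty]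
    linarith

/-- **Lipschitz continuity of the flux envelope**: `|E(θ₁) - E(θ₂)| ≤ 2M|θ₁ - θ₂|` (`L ≥ 2`):
`θ ↦ E_{L,M}(U; θ, N)` is `2M`-Lipschitz, in particular continuous — the sector minimum is a
minimum of finitely many analytic eigenvalue branches, and this is its kinematic modulus. [folklore] -/
theorem abs_tubeEnergy_sub_le (hL : 2 ≤ L) (U θ₁ θ₂ : ℝ) (N : ℕ) :
    |tubeEnergy L M Λ e U θ₁ N - tubeEnergy L M Λ e U θ₂ N| ≤ 2 * M * |θ₁ - θ₂| := by
  rw [abs_sub_le_iff]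
  constructor
  · linarith [tubeEnergy_le_tubeEnergy_add_lipschitz L M Λ e hL U θ₁ θ₂ N]
  · have := tubeEnergy_le_tubeEnergy_add_lipschitz L M Λ e hL U θ₂ θ₁ N
    rw [abs_sub_comm] at this
    linarith

/-- The flux envelope `θ ↦ E_{L,M}(U; θ, N)` is continuous (`L ≥ 2`). [folklore] -/
theorem continuous_tubeEnergy (hL : 2 ≤ L) (U : ℝ) (N : ℕ) :
    Continuous fun θ : ℝ => tubeEnergy L M Λ e U θ N := by
  refine LipschitzWith.continuous (K := 2 * (M : NNReal)) (LipschitzWith.of_dist_le_mul fun θ₁ θ₂ => ?_)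
  rw [Real.dist_eq, Real.dist_eq]
  push_cast
  exact abs_tubeEnergy_sub_le L M Λ e hL U θ₁ θ₂ N

end Lipschitz

end Summit.HubbardSuperconductivity.HubbardSuperconductivity.Theorems.WidthHaldane

end
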